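import Mathlib.Analysis.Calculus.InverseFunctionTheorem.ContDiff
import Mathlib.Analysis.Calculus.ContDiff.RCLike
import Mathlib.LinearAlgebra.FiniteDimensional.Lemmas
import Mathlib.Topology.Algebra.Module.FiniteDimension
import HarnessLib

/-!
# NE7FibreCoordinates — FIBRE COORDINATES FROM A STRAIGHTENING (abstract, finite-dimensional): if `G : S → Y` has `G 0 = 0` and an onto differential `G′` at `0`, and `θ : Y × S → S`
# is `C²` at `0` with `θ 0 = 0`, `G(θ(y,Φ)) = y` and `θ(GΦ, Φ) = Φ` near `0` (the shape of ✓ p821389 `NE7FibreStraightening.fibre_straightening`), then `Λ(y,z) := θ(y,z)` restricted to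
# `z ∈ K := ker G′` is a local `C²` diffeomorphism `Y × K ≅ S` at `0`: there is `π : S → K`, `C²` at `0`, `π 0 = 0`, with `θ(GΦ, πΦ) = Φ` near `0` and `π(θ(y,z)) = z` near `0` — the
# «fibre coordinates» `(y, z) = (GΦ, πΦ)` in which the C¹ rung of the datum-dependence of `U_k(V)` (ROAD-G114 §7 (P1)) is carried out

Cell `pub-balaban`, rung (B)+1 sub-cell t4, lineage `b2b-balaban-t4-ne7-p1` (CRUX PROVER NE7 #1 = OWNER of BINDER row NE7), generation 114.  Memo `t4/b2b-balaban-t4-ne7-p1-g114/ROAD-G114.md` §7.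
THE ARGUMENT.  Differentiating the two identities at `0`: `G′∘T = fst` and `T∘(G′, id) = id` (`T = Dθ(0)`), so `T(ẏ, ż) = 0` with `ż ∈ K` forces `ẏ = G′T(ẏ,ż) = 0` and then `ż = T(G′ż, ż) = T(0,ż) = 0`:
`DΛ(0)` is injective, hence (rank–nullity, `dim Y + dim K = dim S`) an isomorphism; Mathlib's `C^n` inverse function theorem gives the local inverse, whose components are `G` and `π`.
WHAT ([folklore]; 0 def, 0 sorry).  **`fibre_coordinates`**.
HONEST FRAMING (page 1): abstract finite-dimensional calculus; nothing of Bałaban's; NOT NE7, NOT NE3; spine 0∕9; finite T⁴ rung (B)+1 — NOT infinite volume, NOT mass gap, NOT BetaPertH, NOT Clay.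
-/

set_option autoImplicit false

open scoped Topology
open Set Filter Metric Module

namespace Summit.QuantumFields.BalabanUV.T4Continuum.NE7FibreCoordinates

variable {S Y : Type*} [NormedAddCommGroup S] [NormedSpace ℝ S] [FiniteDimensional ℝ S] [NormedAddCommGroup Y] [NormedSpace ℝ Y] [FiniteDimensional ℝ Y]

set_option maxHeartbeats 800000 in
/-- **FIBRE COORDINATES FROM A STRAIGHTENING.**  `G : S → Y`, `G 0 = 0`, `HasFDerivAt G G′ 0` with `G′` onto; `θ : Y × S → S` `C²` at `0`, `θ 0 = 0`, `∀ᶠ p, G (θ p) = p.1`,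
`∀ᶠ Φ, θ (G Φ, Φ) = Φ`.  THEN with `K = ker G′` there is `π : S → K`, `C²` at `0`, `π 0 = 0`, `∀ᶠ Φ, θ (G Φ, π Φ) = Φ`, and `∀ᶠ q : Y × K, π (θ (q.1, q.2)) = q.2`. [folklore] -/
theorem fibre_coordinates {G : S → Y} {G' : S →L[ℝ] Y} {θ : Y × S → S} (hG0 : G 0 = 0) (hGd : HasFDerivAt G G' 0)
    (honto : LinearMap.range (G' : S →ₗ[ℝ] Y) = ⊤) (hθc : ContDiffAt ℝ 2 θ 0) (hθ0 : θ 0 = 0)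
    (hfib : ∀ᶠ p : Y × S in 𝓝 0, G (θ p) = p.1) (hsec : ∀ᶠ Φ : S in 𝓝 0, θ (G Φ, Φ) = Φ) :
    ∃ π : S → ↥(LinearMap.ker (G' : S →ₗ[ℝ] Y)), ContDiffAt ℝ 2 π 0 ∧ π 0 = 0 ∧
      (∀ᶠ Φ : S in 𝓝 0, θ (G Φ, (π Φ : S)) = Φ) ∧
      (∀ᶠ q : Y × ↥(LinearMap.ker (G' : S →ₗ[ℝ] Y)) in 𝓝 0, π (θ (q.1, (q.2 : S))) = q.2) := by
  set K : Submodule ℝ S := LinearMap.ker (G' : S →ₗ[ℝ] Y) with hK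
  haveI : CompleteSpace (Y × ↥K) := FiniteDimensional.complete ℝ _
  -- the differential `T` of `θ` at `0` and the two linearised identities
  have hθd : HasFDerivAt θ (fderiv ℝ θ 0) 0 := (hθc.differentiableAt (by norm_num)).hasFDerivAt
  set T : Y × S →L[ℝ] S := fderiv ℝ θ 0 with hT
  have hid1 : G'.comp T = ContinuousLinearMap.fst ℝ Y S := by
    have h1 : HasFDerivAt (fun p : Y × S => G (θ p)) (G'.comp T) 0 := by
      have hG' : HasFDerivAt G G' (θ 0) := by rw [hθ0]; exact hGd
      exact hG'.comp 0 hθd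
    have h2 : HasFDerivAt (fun p : Y × S => G (θ p)) (ContinuousLinearMap.fst ℝ Y S) 0 :=
      (ContinuousLinearMap.fst ℝ Y S).hasFDerivAt.congr_of_eventuallyEq (hfib.mono fun p hp => hp)
    exact h1.unique h2
  have hid2 : T.comp (G'.prod (ContinuousLinearMap.id ℝ S)) = ContinuousLinearMap.id ℝ S := by
    have hι : HasFDerivAt (fun Φ : S => ((G Φ, Φ) : Y × S)) (G'.prod (ContinuousLinearMap.id ℝ S)) 0 := hGd.prodMk (hasFDerivAt_id 0)
    have hθ' : HasFDerivAt θ T ((G 0, (0 : S)) : Y × S) := by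
      have e : ((G 0, (0 : S)) : Y × S) = 0 := by simp [hG0]
      rw [e]; exact hθd
    have h1 : HasFDerivAt (fun Φ : S => θ (G Φ, Φ)) (T.comp (G'.prod (ContinuousLinearMap.id ℝ S))) 0 :=
      HasFDerivAt.comp (0 : S) (g := θ) (f := fun Φ : S => ((G Φ, Φ) : Y × S)) hθ' hι
    have h2 : HasFDerivAt (fun Φ : S => θ (G Φ, Φ)) (ContinuousLinearMap.id ℝ S) 0 :=
      (hasFDerivAt_id (0 : S)).congr_of_eventuallyEq (hsec.mono fun Φ hΦ => hΦ)
    exact h1.unique h2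
  -- `Λ(y, z) = θ(y, z)` on `Y × K` and its injective differential
  set ι : Y × ↥K →L[ℝ] Y × S := (ContinuousLinearMap.id ℝ Y).prodMap K.subtypeL with hι
  set Λ : Y × ↥K → S := fun q => θ (ι q) with hΛdef
  have hΛθ : ∀ q : Y × ↥K, Λ q = θ (q.1, (q.2 : S)) := fun q => rfl
  have hΛc : ContDiffAt ℝ 2 Λ 0 := by
    have h : ContDiffAt ℝ 2 θ (ι 0) := by rw [map_zero]; exact hθc
    exact h.comp 0 ι.contDiff.contDiffAt
  have hΛd : HasFDerivAt Λ (T.comp ι) 0 := by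
    have h : HasFDerivAt θ T (ι 0) := by rw [map_zero]; exact hθd
    exact h.comp 0 ι.hasFDerivAt
  have hinj : Function.Injective (T.comp ι) := by
    refine (injective_iff_map_eq_zero _).mpr fun q hq => ?_
    obtain ⟨y, z⟩ := q
    have hq' : T (y, (z : S)) = 0 := hq
    have hy : y = 0 := by
      have h := congrArg (fun L : Y × S →L[ℝ] Y => L (y, (z : S))) hid1
      simp only [ContinuousLinearMap.coe_comp, Function.comp_apply, ContinuousLinearMap.coe_fst'] at h
      rw [hq', map_zero] at h
      exact h.symm
    have hz0 : G' (z : S) = 0 := LinearMap.mem_ker.mp z.2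
    have hz : (z : S) = 0 := by
      have h := congrArg (fun L : S →L[ℝ] S => L (z : S)) hid2
      simp only [ContinuousLinearMap.coe_comp, Function.comp_apply, ContinuousLinearMap.prod_apply, ContinuousLinearMap.coe_id', id] at h
      rw [hz0, ← hy, hq'] at h
      exact h.symm
    have hz' : z = 0 := Subtype.ext (by simpa using hz)
    simp [hy, hz']
  -- dimension count: `dim (Y × K) = dim S`
  have hdim : finrank ℝ (Y × ↥K) = finrank ℝ S := by
    have h1 := LinearMap.finrank_range_add_finrank_ker (G' : S →ₗ[ℝ] Y)
    rw [honto, finrank_top] at h1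
    rw [Module.finrank_prod]
    exact h1
  set eL : (Y × ↥K) ≃ₗ[ℝ] S := LinearMap.linearEquivOfInjective ((T.comp ι : Y × ↥K →L[ℝ] S) : Y × ↥K →ₗ[ℝ] S) hinj hdim with heL
  set e : (Y × ↥K) ≃L[ℝ] S := eL.toContinuousLinearEquiv with he
  have hecoe : (e : Y × ↥K →L[ℝ] S) = T.comp ι := by
    ext q
    · rfl
    · rfl
  have hΛe : HasFDerivAt Λ (e : Y × ↥K →L[ℝ] S) 0 := by rw [hecoe]; exact hΛd
  -- the inverse function theorem
  have hs := hΛc.hasStrictFDerivAt' hΛe two_ne_zero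
  have hΛ0 : Λ 0 = 0 := by simp [hΛdef, hθ0]
  set inv := hs.localInverse Λ e 0 with hinv
  have hinvc : ContDiffAt ℝ 2 inv (Λ 0) := hΛc.to_localInverse hΛe two_ne_zero
  rw [hΛ0] at hinvc
  have hleft : ∀ᶠ q : Y × ↥K in 𝓝 0, inv (Λ q) = q := hs.eventually_left_inverse
  have hright : ∀ᶠ Φ : S in 𝓝 0, Λ (inv Φ) = Φ := by have h := hs.eventually_right_inverse; rwa [hΛ0] at h
  have htend : Tendsto inv (𝓝 0) (𝓝 0) := by have h := hs.localInverse_tendsto; rwa [hΛ0] at h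
  -- the first component of the inverse is `G`
  have hfst : ∀ᶠ Φ : S in 𝓝 0, (inv Φ).1 = G Φ := by
    have h1 : ∀ᶠ Φ : S in 𝓝 0, G (θ (ι (inv Φ))) = (ι (inv Φ)).1 := by
      have hι0 : Tendsto (fun Φ => ι (inv Φ)) (𝓝 0) (𝓝 0) := by
        have h := ι.continuous.tendsto (0 : Y × ↥K); rw [map_zero] at h; exact h.comp htend
      exact hι0.eventually hfib
    filter_upwards [h1, hright] with Φ hΦ hΦr
    have e1 : θ (ι (inv Φ)) = Φ := hΦr
    rw [e1] at hΦ
    exact hΦ.symm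
  refine ⟨fun Φ => (inv Φ).2, contDiffAt_snd.comp 0 hinvc, ?_, ?_, ?_⟩
  · -- `π 0 = 0`
    have h : inv 0 = 0 := by have := hs.localInverse_apply_image; rwa [hΛ0] at this
    simp [h]
  · filter_upwards [hright, hfst] with Φ hΦr hΦ1
    have e1 : θ (G Φ, ((inv Φ).2 : S)) = Λ (inv Φ) := by rw [hΛθ, hΦ1]
    rw [e1]; exact hΦr
  · filter_upwards [hleft] with q hq
    have e1 : θ (q.1, (q.2 : S)) = Λ q := (hΛθ q).symm
    rw [e1, hq]

end Summit.QuantumFields.BalabanUV.T4Continuum.NE7FibreCoordinates
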